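import Literature.Geometry.Lorentzian.GaussianBeamDefect
import HarnessLib

/-!
# The data of an explicit Gaussian beam in a time-foliated chart, and the beam function
(trunk G08 = T-LORENTZ, geometric optics; namespace `Literature.Geometry.Lorentzian.GaussianBeam`)

Sbierski, Anal. PDE 8 (2015), §3 (= arXiv:1311.2477v2 §2.2): a Gaussian beam along a null
geodesic `γ` is `u_λ = a e^{iλφ}` with `φ` satisfying the eikonal equation to second order and `a`
the transport equation to zeroth order along `γ`, `Im ∇∇φ|_γ > 0` transversally, `supp a` in a
small neighbourhood of `γ`. The files `GaussianBeamPhase/Defect/Amplitude.lean` construct `φ` and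
`a|_γ` explicitly in a chart `E4 ∋ x = (t, x⃗)` in which the geodesic is a graph `X(t) = (t, c(t))`
over the time axis, from data `(P, M, c, κ)` subject to a list of pointwise relations (null,
velocity, bicharacteristic, Riccati, symmetry, compatibility, constraint, positivity of `Im M`).
This file **bundles those data and relations** into one structure, so that the energy estimates
and the Kerr assembly can quantify over a single object, and introduces the beam function:

* `GaussianBeam.BeamData G V J` — the coefficient field `G = (g^{μν})`, `C^∞` and symmetric on
  the open set `V`, the open parameter interval `J ∋ 0`, the data `P, M, c, κ` (`C^∞` on `J`) and
  the relations of `GaussianBeamDefect.lean` (`hnull`, `hvel`, `hbichar`, `hRic`, `hsymm`, `hMX`,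
  `hPX`), `κ > 0`, `X(t) ∈ V`, and `Im M(t) > 0` on spatial vectors — a `Type`-valued record of
  data and proofs (no named fact);
* derived objects: the curve `X`, the phase `φ = phase P M c`, the open set `U = V ∩ {x⁰ ∈ J}`,
  the smoothness of `X`, of the coefficients and their coordinate derivatives along `X`
  (`contDiffOn_X`, `contDiffOn_coeff_X`, `contDiffOn_dG_X`) and of `φ` on the slab, and the
  coercivity `Im φ ≥ c₀ ‖x⃗ − c(x⁰)‖²` over compact time ranges (`exists_pos_le_im_φ`);
* the elementary `contDiff_mul_of_tsupport` (a `C^n` function supported inside an open set times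
  a function `C^n` on that set is `C^n`), used for the cut-off amplitude and the beam in the
  sequel (`GaussianBeamFunction.lean`: admissible amplitudes `BeamAmp`, the beam `Re(a e^{iλφ})`).

## References

* J. Sbierski, *Characterisation of the energy of Gaussian beams on Lorentzian manifolds: with
  applications to black hole spacetimes*, Anal. PDE 8 (2015) 1379–1420, §3; arXiv:1311.2477v2
  §2.2, pp. 11–15 (key `Sbierski2015`).
-/

noncomputable section

open Set Filter Complex
open scoped ContDiff Topology

namespace Literature.Geometry.Lorentzian

namespace GaussianBeam

/-! ### Products with functions supported inside an open set -/

/-- **A `C^n` function supported inside an open set `U`, times a function `C^n` on `U`, is `C^n`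
on the whole space** (near a point outside `U` the product vanishes identically). [folklore] -/
theorem contDiff_mul_of_tsupport {𝔸 : Type*} [NormedRing 𝔸] [NormedAlgebra ℝ 𝔸]
    {W : Type*} [NormedAddCommGroup W] [NormedSpace ℝ W] {n : ℕ∞ω}
    {f g : W → 𝔸} {U : Set W} (hU : IsOpen U) (hf : ContDiff ℝ n f) (hfs : tsupport f ⊆ U)
    (hg : ContDiffOn ℝ n g U) : ContDiff ℝ n fun x ↦ f x * g x := by
  rw [contDiff_iff_contDiffAt]
  intro x
  by_cases hx : x ∈ U
  · exact hf.contDiffAt.mul (hg.contDiffAt (hU.mem_nhds hx))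
  · have hxf : x ∉ tsupport f := fun h ↦ hx (hfs h)
    have hzero : (fun y ↦ f y * g y) =ᶠ[𝓝 x] fun _ ↦ 0 := by
      filter_upwards [(isClosed_tsupport f).isOpen_compl.mem_nhds hxf] with y hy
      simp [image_eq_zero_of_notMem_tsupport hy]
    exact contDiffAt_const.congr_of_eventuallyEq hzero

/-- The same with the factors in the other order. [folklore] -/
theorem contDiff_mul_of_tsupport' {𝔸 : Type*} [NormedRing 𝔸] [NormedAlgebra ℝ 𝔸]
    {W : Type*} [NormedAddCommGroup W] [NormedSpace ℝ W] {n : ℕ∞ω}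
    {f g : W → 𝔸} {U : Set W} (hU : IsOpen U) (hf : ContDiff ℝ n f) (hfs : tsupport f ⊆ U)
    (hg : ContDiffOn ℝ n g U) : ContDiff ℝ n fun x ↦ g x * f x := by
  rw [contDiff_iff_contDiffAt]
  intro x
  by_cases hx : x ∈ U
  · exact (hg.contDiffAt (hU.mem_nhds hx)).mul hf.contDiffAt
  · have hxf : x ∉ tsupport f := fun h ↦ hx (hfs h)
    have hzero : (fun y ↦ g y * f y) =ᶠ[𝓝 x] fun _ ↦ 0 := by
      filter_upwards [(isClosed_tsupport f).isOpen_compl.mem_nhds hxf] with y hy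
      simp [image_eq_zero_of_notMem_tsupport hy]
    exact contDiffAt_const.congr_of_eventuallyEq hzero

/-! ### The data of a beam -/

/-- **The data of an explicit Gaussian beam** in a time-foliated chart: the coefficients
`G = (g^{μν})` (`C^∞`, symmetric) on the open set `V`, the open interval `J ∋ 0` of times, the
momentum `P(t)`, the complex symmetric `M(t) = ∂∂φ|_{X(t)}`, the spatial curve `c(t)` and the
energy `κ(t) = γ̇⁰ > 0`, with the relations under which the phase `phase P M c` satisfies the
eikonal equation to second order along `X(t) = (t, c(t))` (`GaussianBeamDefect.lean`): null,
velocity (`G(X)P = κẊ`), bicharacteristic, Riccati (with the factor `κ` of the time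
parametrisation), symmetry, compatibility `MẊ = Ṗ`, constraint `P·Ẋ = 0`, and `Im M > 0` on
spatial vectors (Sbierski's (2.12)–(2.17), (2.21)). [cite: Sbierski2015, §3; arXiv v2 §2.2 (2.12)–(2.17), (2.21)] -/
structure BeamData (G : E4 → Fin 4 → Fin 4 → ℝ) (V : Set E4) (J : Set ℝ) where
  /-- the momentum `P(t) = dφ|_{X(t)}` -/
  P : ℝ → Fin 4 → ℝ
  /-- the Hessian `M(t) = ∂∂φ|_{X(t)}` -/
  M : ℝ → Fin 4 → Fin 4 → ℂ
  /-- the spatial curve, `X(t) = (t, c(t))` -/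
  c : ℝ → E3
  /-- the energy `κ(t) = γ̇⁰` of the time parametrisation -/
  κ : ℝ → ℝ
  hV : IsOpen V
  hG : ∀ μ ν, ContDiffOn ℝ ∞ (fun x ↦ G x μ ν) V
  hGsymm : ∀ x μ ν, G x μ ν = G x ν μ
  hJ : IsOpen J
  hJc : J.OrdConnected
  h0 : (0 : ℝ) ∈ J
  hP : ∀ μ, ContDiffOn ℝ ∞ (fun t ↦ P t μ) J
  hM : ∀ μ ν, ContDiffOn ℝ ∞ (fun t ↦ M t μ ν) J
  hc : ∀ i, ContDiffOn ℝ ∞ (fun t ↦ c t i) J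
  hκ : ContDiffOn ℝ ∞ κ J
  hκpos : ∀ t ∈ J, 0 < κ t
  hXV : ∀ t ∈ J, E4.ofTimeSpace t (c t) ∈ V
  hPX : ∀ t ∈ J, P t 0 + ∑ i : Fin 3, P t i.succ * cdot c t i = 0
  hsymm : ∀ t ∈ J, ∀ μ ν, M t μ ν = M t ν μ
  hMX : ∀ t ∈ J, ∀ μ, ∑ ν : Fin 4, M t μ ν * (xdot c t ν : ℂ) = (pdot P t μ : ℂ)
  hvel : ∀ t ∈ J, ∀ μ, ∑ ν : Fin 4, G (E4.ofTimeSpace t (c t)) μ ν * P t ν = κ t * xdot c t μ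
  hbichar : ∀ t ∈ J, ∀ α, ∑ μ : Fin 4, ∑ ν : Fin 4,
    dG G (E4.ofTimeSpace t (c t)) α μ ν * P t μ * P t ν = -2 * κ t * pdot P t α
  hnull : ∀ t ∈ J, ∑ μ : Fin 4, ∑ ν : Fin 4, G (E4.ofTimeSpace t (c t)) μ ν * P t μ * P t ν = 0
  hRic : ∀ t ∈ J, ∀ μ ν, (κ t : ℂ) * mdot M t μ ν =
    -(2⁻¹ * (riccatiA2 (ddG G (E4.ofTimeSpace t (c t))) (P t) μ ν : ℂ) +
      ∑ ρ : Fin 4, ((riccatiB (dG G (E4.ofTimeSpace t (c t))) (P t) μ ρ : ℂ) * M t ρ ν +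
        M t μ ρ * (riccatiB (dG G (E4.ofTimeSpace t (c t))) (P t) ν ρ : ℂ)) +
      ∑ ρ : Fin 4, ∑ σ : Fin 4, M t μ ρ * (G (E4.ofTimeSpace t (c t)) ρ σ : ℂ) * M t σ ν)
  hIm : ∀ t ∈ J, ∀ d : E3, d ≠ 0 →
    0 < ∑ i : Fin 3, ∑ j : Fin 3, (M t i.succ j.succ).im * d i * d j

namespace BeamData

variable {G : E4 → Fin 4 → Fin 4 → ℝ} {V : Set E4} {J : Set ℝ} (D : BeamData G V J)

/-- The curve `X(t) = (t, c(t))`. [cite: Sbierski2015, §3] -/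
def X (t : ℝ) : E4 := E4.ofTimeSpace t (D.c t)

/-- The phase of the beam. [cite: Sbierski2015, §3 (3.12)] -/
def φ : E4 → ℂ := phase D.P D.M D.c

/-- The open slab over `J` intersected with `V`: the set where all ingredients are smooth. [folklore] -/
theorem isOpen_inter_slab (D : BeamData G V J) : IsOpen (V ∩ {x : E4 | x 0 ∈ J}) :=
  IsOpen.inter D.hV (isOpen_slab D.hJ)

/-- The time coordinate of `X(t)` is `t`. [folklore] -/
theorem X_apply_zero (t : ℝ) : D.X t 0 = t := by simp [X]

/-- `X(t)` lies in `V` and in the slab over `J`. [folklore] -/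
theorem X_mem {t : ℝ} (ht : t ∈ J) : D.X t ∈ V ∩ {x : E4 | x 0 ∈ J} :=
  ⟨D.hXV t ht, by simpa [X] using ht⟩

/-- The curve is `C^∞` on `J` (as a map into the chart). [folklore] -/
theorem contDiffOn_X : ContDiffOn ℝ ∞ D.X J := by
  rw [contDiffOn_piLp]
  intro i
  refine Fin.cases ?_ (fun j ↦ ?_) i
  · simp only [X, E4.ofTimeSpace_apply_zero]
    exact contDiffOn_id
  · simp only [X, E4.ofTimeSpace_apply_succ]
    exact D.hc j

/-- The coefficients along the curve are `C^∞`. [folklore] -/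
theorem contDiffOn_coeff_X (μ ν : Fin 4) : ContDiffOn ℝ ∞ (fun t ↦ G (D.X t) μ ν) J :=
  (D.hG μ ν).comp D.contDiffOn_X fun t ht ↦ D.hXV t ht

/-- The coordinate derivatives of the coefficients along the curve are `C^∞`. [folklore] -/
theorem contDiffOn_dG_X (α μ ν : Fin 4) : ContDiffOn ℝ ∞ (fun t ↦ dG G (D.X t) α μ ν) J :=
  (contDiffOn_fderiv_coeff_apply G D.hV D.hG (E4.basisVector α) μ ν).comp D.contDiffOn_X
    fun t ht ↦ D.hXV t ht

/-- The phase is `C^∞` on the slab over `J`. [cite: Sbierski2015, §3 (3.12)] -/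
theorem contDiffOn_φ : ContDiffOn ℝ ∞ D.φ {x : E4 | x 0 ∈ J} := contDiffOn_phase D.hP D.hM D.hc

/-- **Coercivity of `Im φ`** on the slab over a compact set of times `K ⊆ J`:
`Im φ(x) ≥ c₀ ‖x⃗ − c(x⁰)‖²`. [cite: Sbierski2015, §3 (display preceding the first lemma)] -/
theorem exists_pos_le_im_φ {K : Set ℝ} (hK : IsCompact K) (hKJ : K ⊆ J) :
    ∃ c₀ : ℝ, 0 < c₀ ∧ ∀ x : E4, x 0 ∈ K →
      c₀ * ‖E4.spatial x - D.c (x 0)‖ ^ 2 ≤ (D.φ x).im := by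
  have hMc : ∀ i j : Fin 3, ContinuousOn (fun t ↦ (D.M t i.succ j.succ).im) K := fun i j ↦
    (Complex.continuous_im.comp_continuousOn (D.hM i.succ j.succ).continuousOn).mono hKJ
  obtain ⟨c₀, hc₀, h⟩ := exists_pos_le_im_phase (P := D.P) (M := D.M) (c := D.c) hK hMc
    fun t ht ↦ D.hIm t (hKJ ht)
  refine ⟨c₀, hc₀, fun x hx ↦ ?_⟩
  have hnorm : ‖E4.spatial x - D.c (x 0)‖ ^ 2 = ∑ i : Fin 3, disp D.c x i ^ 2 := by
    rw [EuclideanSpace.norm_sq_eq]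
    simp [disp]
  rw [hnorm]
  exact h x hx

end BeamData

end GaussianBeam

end Literature.Geometry.Lorentzian
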